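import Literature.NumberTheory.Automorphic.RankinSelbergSiegelFiniteness
import Literature.NumberTheory.Automorphic.GLnCuspidalSiegelDecay
import Literature.NumberTheory.Automorphic.SiegelShellDomination
import HarnessLib

/-!
# The Rankin–Selberg integrand on the dyadic shells of `A_G 𝔖`: a summable bound

Topic `NumberTheory/Automorphic`; namespace `Literature.NumberTheory.Automorphic`. Proof file
(theorems only). The analytic estimate of the finiteness half of the real-point Rankin–Selberg method
on `GL_n` in the covering-weight form of the tree (Jacquet–Shalika (1981), §4; Cogdell (2004), §2.3,
p. 211: `∫ |φ|² E(·, Φ, σ)` "converges absolutely"; Godement–Jacquet (1972), §11–12). After unfolding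
the `P_n(K)`-weight (`RankinSelbergEisensteinWeight`) and dominating by `A_G 𝔖`
(`SiegelShellDomination`), one must bound, on the `j`-th dyadic shell `z(e^{[j,j+1]}) 𝔖` of the centre,

  `‖φ(s)‖² · |det (z s)|_𝔸^σ Σ_{v ∈ Kⁿ ∖ 0} Φ(v z s)`,  `s ∈ 𝔖 = Ω A_{T₀}(t) K`, `z = z(e^τ)`,

by a summable `ε_j`. Here (`exists_shell_bound`, **main**) this is done for `φ` continuous,
invariant under `A_G` and rapidly decreasing (`IsRapidlyDecreasingGL`; for `φ = invQuot (S_η f)`,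
`f ∈ L²_cusp`, this is `isRapidlyDecreasingGL_smoothedForm_inv` of `GLnCuspidalSiegelDecay`), `Φ ≥ 0` a
standard Schwartz–Bruhat function and `σ > 1`:

1. `s = ω a k = a · y`, `y = (a⁻¹ ω a) k` in a fixed compact `C₁`
   (`exists_isCompact_conj_siegelCone_mem_of_subset`), `|det z(e^τ)| = e^{τ n [K:ℚ]}`, `|det a| = 1`,
   `|det y| ≤ D`;
2. `Φ(x y) ≤ Φ₀(x)` for a radial majorant `Φ₀` (`exists_radialMajorant_of_isCompact`), and
   `Φ₀(z (v a)) ≤ Φ₀(z(e^τ m) v)` for `a = diag(z(b))`, `b_i ≥ m` (radial monotonicity), so the theta sum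
   at `z s` is at most the theta sum of `Φ₀` at the scalar `z(e^τ m)` (`tsum_theta_le_of_scalar`), which is
   `≤ M (c e^τ m)^{-θ} Z_θ` for every `0 ≤ θ ≤ k` (`exists_tsum_enorm_smul_le_of_decay` at `g = 1`,
   `Z_θ < ∞` for `θ > n [K:ℚ]`, `tsum_norm_vecInfinitePart_rpow_neg_lt_top`);
3. on the cone `m ≥ (Tⁿ Rⁿ)⁻¹` (`inv_le_of_siegelCone`, `R` the largest simple root) while rapid decay gives
   `‖φ(a y)‖ ≤ C_φ R^{-B}`, `B = n k` (`exists_uniform_rapidDecay`), so `R^{nθ - 2B} ≤ 1`;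
4. with `θ = k > n[K:ℚ]σ` for `j ≥ 0` and `θ = θ₁ ∈ (n[K:ℚ], n[K:ℚ]σ)` for `j < 0` the bound is
   `ε_j = A e^{j(n[K:ℚ]σ - k)}`, resp. `A' e^{(j+1)(n[K:ℚ]σ - θ₁)}`, two convergent geometric series.

## References

* H. Jacquet, J. A. Shalika, Amer. J. Math. 103 (1981), §4 [JacquetShalikaAJM1981].
* R. Godement, H. Jacquet, *Zeta functions of simple algebras*, LNM 260 (1972), §11 [GodementJacquetLNM260].
* J. W. Cogdell, in *An Introduction to the Langlands Program* (2004), §2.3 [CogdellAnalyticTheory2004].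
-/

noncomputable section

open MeasureTheory Measure NumberField NumberField.mixedEmbedding IsDedekindDomain Matrix Set Filter Topology Module
open scoped MatrixGroups ENNReal NNReal Pointwise Classical
open Literature.NumberTheory.GaloisRepresentations (ideleGroup)

namespace Literature.NumberTheory.Automorphic

variable {n : ℕ} {K : Type} [Field K] [NumberField K]

/-! ### The theta sum at a scalar: reindexing by a principal idele and the sup bound at `g = 1` -/

section Theta

/-- Scaling a non-zero vector by a non-zero rational scalar permutes `Kⁿ ∖ 0`. [folklore] -/
def smulNeZeroEquiv (c : Kˣ) : ↥{v : Fin n → K | v ≠ 0} ≃ ↥{v : Fin n → K | v ≠ 0} where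
  toFun v := ⟨(c : K) • v.1, smul_ne_zero c.ne_zero v.2⟩
  invFun v := ⟨((c⁻¹ : Kˣ) : K) • v.1, smul_ne_zero c⁻¹.ne_zero v.2⟩
  left_inv v := Subtype.ext (by simp only [smul_smul, Units.inv_mul, one_smul])
  right_inv v := Subtype.ext (by simp only [smul_smul, Units.mul_inv, one_smul])

/-- **A principal idele scalar does not change the theta sum**:
`Σ_{v ≠ 0} F((k) • v) = Σ_{v ≠ 0} F(v)` on principal adelic vectors, `(k) • ratVec v = ratVec (k v)`.
[folklore] -/
theorem tsum_principalIdele_smul_ratVec (k : Kˣ) (F : (Fin n → AdeleRing (𝓞 K) K) → ℝ≥0∞) :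
    ∑' v : ↥{v : Fin n → K | v ≠ 0},
        F (((principalIdele K k : ideleGroup K) : AdeleRing (𝓞 K) K) • ratVec K v.1) =
      ∑' v : ↥{v : Fin n → K | v ≠ 0}, F (ratVec K v.1) := by
  have h : ∀ v : ↥{v : Fin n → K | v ≠ 0},
      ((principalIdele K k : ideleGroup K) : AdeleRing (𝓞 K) K) • ratVec K v.1 = ratVec K ((smulNeZeroEquiv k v).1) := by
    intro v
    change _ = ratVec K ((k : K) • v.1)
    rw [ratVec_smul]
    rfl
  simp_rw [h]
  exact Equiv.tsum_eq (smulNeZeroEquiv k) fun v => F (ratVec K v.1)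

/-- `z(ρ) w ∈ Y_ρ` for `w ∈ W` (as `1 ∈ P`). [folklore] -/
theorem posRealIdele_mul_mem_dyadicIdeleSet (ρ : ℝ≥0ˣ) {w : ideleGroup K} (hw : w ∈ normOneIdeleCover K) :
    posRealIdele K ρ * w ∈ dyadicIdeleSet K ρ := by
  refine Set.smul_mem_smul_set (a := posRealIdele K ρ) ⟨1, ?_, w, hw, one_mul w⟩
  refine ⟨0, ⟨?_, ?_⟩, by show posRealIdele K (expUnitNNReal 0) = 1; rw [expUnitNNReal_zero, map_one]⟩
  · have : (0 : ℝ) ≤ Real.log 2 / finrank ℚ K := div_nonneg (Real.log_nonneg one_le_two) (Nat.cast_nonneg _)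
    rw [neg_div]; linarith
  · exact div_nonneg (Real.log_nonneg (by norm_num)) (Nat.cast_nonneg _)

/-- **The theta sum of a decaying function at a positive real scalar.** Let `Φ₀ : 𝔸_Kⁿ → ℂ` satisfy
`|Φ₀(x)| ≤ M (1 + ‖x_∞‖)^{-k}` and vanish unless `x_f` lies in a compact set. There are `c > 0` and a
compact set `C` of finite-adelic vectors such that for every `0 ≤ θ ≤ k` and every `ρ > 0`,
`Σ_{v ∈ Kⁿ ∖ 0} |Φ₀(z(ρ) v)| ≤ M (c ρ)^{-θ} · Σ_{v ≠ 0, v_f ∈ C} ‖v_∞‖^{-θ}` (the right side written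
with `v · 1` as in `tsum_norm_vecInfinitePart_rpow_neg_lt_top`)
(`exists_tsum_enorm_smul_le_of_decay` at `g = 1` and `y = z(ρ) w₀` with `w₀ ∈ W` principal, which does
not change the sum). [folklore] -/
theorem exists_tsum_theta_scalar_le {Φ₀ : (Fin n → AdeleRing (𝓞 K) K) → ℂ} {k : ℕ} {M : ℝ} (hM0 : 0 ≤ M)
    (hM : ∀ x, ‖Φ₀ x‖ ≤ M * (1 + ‖vecInfinitePart K n x‖) ^ (-(k : ℝ)))
    {Cf : Set (Fin n → FiniteAdeleRing (𝓞 K) K)} (hCfc : IsCompact Cf)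
    (hCf : ∀ x, vecFinitePart K n x ∉ Cf → Φ₀ x = 0) :
    ∃ (c : ℝ) (C : Set (Fin n → FiniteAdeleRing (𝓞 K) K)), 0 < c ∧ IsCompact C ∧
      ∀ θ : ℝ, 0 ≤ θ → θ ≤ k → ∀ ρ : ℝ≥0ˣ,
        ∑' v : ↥{v : Fin n → K | v ≠ 0},
            (‖Φ₀ (((posRealIdele K ρ : ideleGroup K) : AdeleRing (𝓞 K) K) • ratVec K v.1)‖ₑ : ℝ≥0∞) ≤
          ENNReal.ofReal (M * (c * ((ρ : ℝ≥0) : ℝ)) ^ (-θ)) *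
            ∑' v : ↥{v : Fin n → K | v ≠ 0 ∧ vecFinitePart K n (ratVec K v ᵥ*
                ((1 : GL (Fin n) (AdeleRing (𝓞 K) K)) : Matrix (Fin n) (Fin n) (AdeleRing (𝓞 K) K))) ∈ C},
              ENNReal.ofReal (‖vecInfinitePart K n (ratVec K (v : Fin n → K) ᵥ*
                ((1 : GL (Fin n) (AdeleRing (𝓞 K) K)) : Matrix (Fin n) (Fin n) (AdeleRing (𝓞 K) K)))‖ ^ (-θ)) := by
  obtain ⟨c, C, hc, hC, hbound⟩ := exists_tsum_enorm_smul_le_of_decay K (n := n) 1 hM0 hM hCfc hCf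
  -- a principal idele in the cover `W`
  obtain ⟨k₀, w₀, hw₀, h1⟩ := exists_mem_normOneIdeleCover_mul_principalIdele (K := K) (x := 1) (map_one _)
  have hw₀e : w₀ = principalIdele K k₀⁻¹ := by
    rw [map_inv, eq_inv_iff_mul_eq_one, ← h1]
  refine ⟨c, C, hc, hC, fun θ hθ0 hθk ρ => ?_⟩
  have h := hbound θ hθ0 hθk ρ (posRealIdele K ρ * w₀) (posRealIdele_mul_mem_dyadicIdeleSet ρ hw₀)
  refine le_trans (le_of_eq ?_) h
  -- the two sums agree: `(z w₀) • (v · 1) = z • (k₀⁻¹ v)`, and `v ↦ k₀⁻¹ v` permutes `Kⁿ ∖ 0`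
  have e1 : ∀ v : ↥{v : Fin n → K | v ≠ 0},
      ((posRealIdele K ρ * w₀ : ideleGroup K) : AdeleRing (𝓞 K) K) •
          (ratVec K v.1 ᵥ* ((1 : GL (Fin n) (AdeleRing (𝓞 K) K)) : Matrix (Fin n) (Fin n) (AdeleRing (𝓞 K) K))) =
        ((posRealIdele K ρ : ideleGroup K) : AdeleRing (𝓞 K) K) •
          (((principalIdele K k₀⁻¹ : ideleGroup K) : AdeleRing (𝓞 K) K) • ratVec K v.1) := by
    intro v
    rw [Matrix.GeneralLinearGroup.coe_one, Matrix.vecMul_one, hw₀e, Units.val_mul, mul_smul]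
  rw [tsum_congr fun v => congrArg (fun x => (‖Φ₀ x‖ₑ : ℝ≥0∞)) (e1 v)]
  exact (tsum_principalIdele_smul_ratVec k₀⁻¹ fun x =>
    (‖Φ₀ (((posRealIdele K ρ : ideleGroup K) : AdeleRing (𝓞 K) K) • x)‖ₑ : ℝ≥0∞)).symm

end Theta

/-! ### The theta sum on the Siegel set against the theta sum of the majorant at a scalar -/

section Siegel

/-- `v (z g) = z • (v g)` for the central element `z = scalarExp τ`. [folklore] -/
theorem vecMul_scalarExp_mul (v : Fin n → AdeleRing (𝓞 K) K) (τ : ℝ) (g : GL (Fin n) (AdeleRing (𝓞 K) K)) :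
    v ᵥ* ((scalarExp n K τ * g : GL (Fin n) (AdeleRing (𝓞 K) K)) : Matrix (Fin n) (Fin n) (AdeleRing (𝓞 K) K)) =
      ((posRealIdele K (expUnitNNReal τ) : ideleGroup K) : AdeleRing (𝓞 K) K) •
        (v ᵥ* (g : Matrix (Fin n) (Fin n) (AdeleRing (𝓞 K) K))) :=
  vecMul_scalar_mul v (posRealIdele K (expUnitNNReal τ)) g

/-- **Domination of the theta sum on the Siegel set.** Let `Φ : 𝔸_Kⁿ → ℝ` be non-negative and dominated
on right translates by `c ∈ C₁` by a radial majorant: `|Φ(x c)| ≤ Φ₀(x)`,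
`Φ₀(x) = M (1 + ‖x_∞‖)^{-k} 𝟙_C(x_f)`. Then for `y ∈ C₁`, `a = diag(z(b))` with `b_j ≥ m > 0` and
`z = z(e^τ)`,

  `Σ_{v ≠ 0} Φ(v (z a y)) ≤ Σ_{v ≠ 0} Φ₀(z(e^τ m) • v)`

(termwise: `v (z a y) = (z • (v a)) y`, domination, and radial monotonicity
`‖(z • (v a))_∞‖ ≥ e^τ m ‖v_∞‖`, `(z • (v a))_f = v_f`). [folklore] -/
theorem tsum_theta_siegel_le {Φ : (Fin n → AdeleRing (𝓞 K) K) → ℝ} (hΦ0 : ∀ x, 0 ≤ Φ x) {M : ℝ} (hM0 : 0 ≤ M)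
    (k : ℕ) (C : Set (Fin n → FiniteAdeleRing (𝓞 K) K)) {C₁ : Set (GL (Fin n) (AdeleRing (𝓞 K) K))}
    (hdom : ∀ c ∈ C₁, ∀ x : Fin n → AdeleRing (𝓞 K) K,
      ‖((Φ (x ᵥ* (c : Matrix (Fin n) (Fin n) (AdeleRing (𝓞 K) K))) : ℝ) : ℂ)‖ ≤
        ‖(((M * (1 + ‖vecInfinitePart K n x‖) ^ (-(k : ℝ)) *
          C.indicator (fun _ => (1 : ℝ)) (vecFinitePart K n x) : ℝ) : ℂ))‖)
    {y : GL (Fin n) (AdeleRing (𝓞 K) K)} (hy : y ∈ C₁) {m : ℝ≥0ˣ} {b : Fin n → ℝ≥0ˣ}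
    (hb : ∀ j, ((m : ℝ≥0) : ℝ) ≤ ((b j : ℝ≥0) : ℝ)) (τ : ℝ) :
    ∑' v : ↥{v : Fin n → K | v ≠ 0}, ENNReal.ofReal
        (Φ (ratVec K v.1 ᵥ* ((scalarExp n K τ * posRealDiagonal n K b * y : GL (Fin n) (AdeleRing (𝓞 K) K)) :
          Matrix (Fin n) (Fin n) (AdeleRing (𝓞 K) K)))) ≤
      ∑' v : ↥{v : Fin n → K | v ≠ 0},
        (‖(((M * (1 + ‖vecInfinitePart K n (((posRealIdele K (expUnitNNReal τ * m) : ideleGroup K) :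
            AdeleRing (𝓞 K) K) • ratVec K v.1)‖) ^ (-(k : ℝ)) *
          C.indicator (fun _ => (1 : ℝ)) (vecFinitePart K n (((posRealIdele K (expUnitNNReal τ * m) : ideleGroup K) :
            AdeleRing (𝓞 K) K) • ratVec K v.1)) : ℝ) : ℂ))‖ₑ : ℝ≥0∞) := by
  refine ENNReal.tsum_le_tsum fun v => ?_
  set z : AdeleRing (𝓞 K) K := ((posRealIdele K (expUnitNNReal τ) : ideleGroup K) : AdeleRing (𝓞 K) K) with hz
  set w : Fin n → AdeleRing (𝓞 K) K :=
    ratVec K v.1 ᵥ* (posRealDiagonal n K b : Matrix (Fin n) (Fin n) (AdeleRing (𝓞 K) K)) with hw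
  -- `v (z a y) = (z • (v a)) y`
  have hvec : ratVec K v.1 ᵥ* ((scalarExp n K τ * posRealDiagonal n K b * y : GL (Fin n) (AdeleRing (𝓞 K) K)) :
      Matrix (Fin n) (Fin n) (AdeleRing (𝓞 K) K)) = (z • w) ᵥ* (y : Matrix (Fin n) (Fin n) (AdeleRing (𝓞 K) K)) := by
    rw [mul_assoc, vecMul_scalarExp_mul, Matrix.GeneralLinearGroup.coe_mul, ← Matrix.vecMul_vecMul,
      Matrix.smul_vecMul]
  -- `ofReal Φ = ‖(Φ : ℂ)‖ₑ ≤ ‖Φ₀(z • w)‖ₑ`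
  have h1 : ENNReal.ofReal (Φ ((z • w) ᵥ* (y : Matrix (Fin n) (Fin n) (AdeleRing (𝓞 K) K)))) ≤
      (‖(((M * (1 + ‖vecInfinitePart K n (z • w)‖) ^ (-(k : ℝ)) *
        C.indicator (fun _ => (1 : ℝ)) (vecFinitePart K n (z • w)) : ℝ) : ℂ))‖ₑ : ℝ≥0∞) := by
    rw [← ofReal_norm]
    refine (ENNReal.ofReal_le_ofReal ?_).trans (ENNReal.ofReal_le_ofReal (hdom y hy (z • w)))
    rw [Complex.norm_real, Real.norm_of_nonneg (hΦ0 _)]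
  rw [hvec]
  refine h1.trans ?_
  -- radial monotonicity from `z(e^τ m) • v` to `z • w`
  rw [← ofReal_norm, ← ofReal_norm]
  refine ENNReal.ofReal_le_ofReal (norm_radialMajorant_le_of_le hM0 k C ?_ ?_)
  · -- `‖(z(e^τ m) v)_∞‖ = e^τ m ‖v_∞‖ ≤ e^τ ‖(v a)_∞‖ = ‖(z • w)_∞‖`
    have hm : (0 : ℝ) < ((m : ℝ≥0) : ℝ) := NNReal.coe_pos.2 (pos_iff_ne_zero.2 m.ne_zero)
    rw [vecInfinitePart_posRealIdele_smul, hz, vecInfinitePart_posRealIdele_smul, _root_.norm_smul, _root_.norm_smul,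
      Real.norm_of_nonneg (NNReal.coe_nonneg _), Real.norm_of_nonneg (NNReal.coe_nonneg _), Units.val_mul,
      NNReal.coe_mul, mul_assoc]
    exact mul_le_mul_of_nonneg_left (mul_norm_vecInfinitePart_le_of_le K hm hb (ratVec K v.1)) (NNReal.coe_nonneg _)
  · rw [vecFinitePart_smul, hz, vecFinitePart_smul, posRealIdele_snd, posRealIdele_snd, one_smul, one_smul, hw,
      vecFinitePart_vecMul_posRealDiagonal]

end Siegel

/-! ### The summable shell bound -/

section Main

/-- The real bookkeeping of the shell bound: with `r = e^τ`, `R ≥ 1`, `T, c, m > 0`, `0 ≤ θ ≤ k`,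
`m ≥ (Tⁿ Rⁿ)⁻¹`,
`(C_φ R^{-nk})² · (r^{N} D)^σ · (M (c (r m))^{-θ}) ≤ (C_φ² Dσ M c^{-θ} T^{nθ}) · e^{τ (Nσ - θ)}`
(`Dσ = D^σ`, `N = n [K:ℚ]`). [folklore] -/
theorem shell_real_bound {n : ℕ} {Cφ D Dσ M c T R m r τ θ N σ : ℝ} {k : ℕ}
    (hDσ : (r ^ N * D) ^ σ ≤ r ^ (N * σ) * Dσ) (hDσ0 : 0 ≤ Dσ) (hM : 0 ≤ M) (hc : 0 < c) (hT : 0 < T)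
    (hR : 1 ≤ R) (hm : 0 < m) (hmle : (T ^ n * R ^ n)⁻¹ ≤ m) (hr : r = Real.exp τ) (hθ0 : 0 ≤ θ) (hθk : θ ≤ k) :
    (Cφ * R ^ (-((n : ℝ) * k))) ^ 2 * (r ^ N * D) ^ σ * (M * (c * (r * m)) ^ (-θ)) ≤
      (Cφ ^ 2 * Dσ * M * c ^ (-θ) * T ^ ((n : ℝ) * θ)) * Real.exp (τ * (N * σ - θ)) := by
  have hr0 : 0 < r := by rw [hr]; exact Real.exp_pos τ
  have hR0 : 0 < R := one_pos.trans_le hR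
  have hTR : 0 < T ^ n * R ^ n := mul_pos (pow_pos hT n) (pow_pos hR0 n)
  -- `(c r m)^{-θ} = c^{-θ} r^{-θ} m^{-θ}` and `m^{-θ} ≤ (Tⁿ Rⁿ)^θ = T^{nθ} R^{nθ}`
  have h1 : (c * (r * m)) ^ (-θ) = c ^ (-θ) * r ^ (-θ) * m ^ (-θ) := by
    rw [Real.mul_rpow hc.le (mul_pos hr0 hm).le, Real.mul_rpow hr0.le hm.le, mul_assoc]
  have h2 : m ^ (-θ) ≤ T ^ ((n : ℝ) * θ) * R ^ ((n : ℝ) * θ) := by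
    calc m ^ (-θ) ≤ ((T ^ n * R ^ n)⁻¹) ^ (-θ) :=
          Real.rpow_le_rpow_of_nonpos (inv_pos.2 hTR) hmle (neg_nonpos.2 hθ0)
      _ = (T ^ n * R ^ n) ^ θ := by rw [Real.inv_rpow hTR.le, Real.rpow_neg hTR.le, inv_inv]
      _ = T ^ ((n : ℝ) * θ) * R ^ ((n : ℝ) * θ) := by
          rw [Real.mul_rpow (pow_pos hT n).le (pow_pos hR0 n).le, ← Real.rpow_natCast T n, ← Real.rpow_natCast R n,
            ← Real.rpow_mul hT.le, ← Real.rpow_mul hR0.le]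
  -- `r^{Nσ} r^{-θ} = e^{τ(Nσ - θ)}`
  have h3 : Real.exp (τ * (N * σ - θ)) = r ^ (N * σ) * r ^ (-θ) := by
    rw [hr, ← Real.exp_mul, ← Real.exp_mul, ← Real.exp_add]
    congr 1; ring1
  -- `R^{-2nk} R^{nθ} ≤ 1`
  have h4 : (R ^ (-((n : ℝ) * k))) ^ 2 * R ^ ((n : ℝ) * θ) ≤ 1 := by
    rw [← Real.rpow_natCast (R ^ (-((n : ℝ) * k))) 2, ← Real.rpow_mul hR0.le, ← Real.rpow_add hR0]
    refine Real.rpow_le_one_of_one_le_of_nonpos hR ?_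
    have : (n : ℝ) * θ ≤ (n : ℝ) * k := mul_le_mul_of_nonneg_left hθk (Nat.cast_nonneg n)
    push_cast; nlinarith
  -- assemble
  have hpos1 : 0 ≤ Cφ ^ 2 * Dσ * M * c ^ (-θ) * T ^ ((n : ℝ) * θ) := by positivity
  calc (Cφ * R ^ (-((n : ℝ) * k))) ^ 2 * (r ^ N * D) ^ σ * (M * (c * (r * m)) ^ (-θ))
      ≤ (Cφ * R ^ (-((n : ℝ) * k))) ^ 2 * (r ^ (N * σ) * Dσ) * (M * (c ^ (-θ) * r ^ (-θ) * (T ^ ((n : ℝ) * θ) * R ^ ((n : ℝ) * θ)))) := by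
        rw [h1]
        gcongr
    _ = (Cφ ^ 2 * Dσ * M * c ^ (-θ) * T ^ ((n : ℝ) * θ)) * (r ^ (N * σ) * r ^ (-θ)) *
          ((R ^ (-((n : ℝ) * k))) ^ 2 * R ^ ((n : ℝ) * θ)) := by ring1
    _ ≤ (Cφ ^ 2 * Dσ * M * c ^ (-θ) * T ^ ((n : ℝ) * θ)) * (r ^ (N * σ) * r ^ (-θ)) * 1 := by
        gcongr
    _ = (Cφ ^ 2 * Dσ * M * c ^ (-θ) * T ^ ((n : ℝ) * θ)) * Real.exp (τ * (N * σ - θ)) := by rw [mul_one, h3]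

/-- Summability of the two geometric families `A e^{j q}` (`j ≥ 0`, `q < 0`) and `A' e^{(j+1) q'}`
(`j < 0`, `q' > 0`) over `ℤ`, in `[0, ∞]`. [folklore] -/
theorem tsum_int_shellConst_ne_top {A A' : ℝ≥0∞} (hA : A ≠ ⊤) (hA' : A' ≠ ⊤) {q q' : ℝ} (hq : q < 0) (hq' : 0 < q') :
    (∑' j : ℤ, (if 0 ≤ j then A * ENNReal.ofReal (Real.exp (j * q)) else A' * ENNReal.ofReal (Real.exp ((j + 1) * q')))) ≠ ⊤ := by
  set ε : ℤ → ℝ≥0∞ := fun j => if 0 ≤ j then A * ENNReal.ofReal (Real.exp (j * q))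
    else A' * ENNReal.ofReal (Real.exp ((j + 1) * q')) with hε
  change (∑' j : ℤ, ε j) ≠ ⊤
  rw [tsum_of_nat_of_neg_add_one (f := ε) ENNReal.summable ENNReal.summable]
  have h1 : ∀ m : ℕ, ε m = A * ENNReal.ofReal (Real.exp q) ^ m := by
    intro m
    simp only [hε, Int.cast_natCast, Nat.cast_nonneg, if_true]
    rw [← ENNReal.ofReal_pow (Real.exp_pos q).le, ← Real.exp_nat_mul, mul_comm]
  have h2 : ∀ m : ℕ, ε (-(m + 1 : ℤ)) = A' * ENNReal.ofReal (Real.exp (-q')) ^ m := by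
    intro m
    have hneg : ¬ (0 : ℤ) ≤ -(m + 1 : ℤ) := by omega
    simp only [hε, hneg, if_false]
    rw [← ENNReal.ofReal_pow (Real.exp_pos _).le, ← Real.exp_nat_mul]
    congr 2
    have : ((-(m + 1 : ℤ) : ℝ) + 1) * q' = (m : ℝ) * (-q') := by push_cast; ring1
    rw [← this]
    norm_cast
  simp_rw [h1]
  have h2' : (fun m : ℕ => ε (-(m + 1))) = fun m : ℕ => A' * ENNReal.ofReal (Real.exp (-q')) ^ m := by
    funext m; exact_mod_cast h2 m
  rw [h2', ENNReal.tsum_mul_left, ENNReal.tsum_mul_left, ENNReal.tsum_geometric, ENNReal.tsum_geometric]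
  have hlt1 : ENNReal.ofReal (Real.exp q) < 1 := by
    rw [← ENNReal.ofReal_one]; exact (ENNReal.ofReal_lt_ofReal_iff one_pos).2 (Real.exp_lt_one_iff.2 hq)
  have hlt2 : ENNReal.ofReal (Real.exp (-q')) < 1 := by
    rw [← ENNReal.ofReal_one]; exact (ENNReal.ofReal_lt_ofReal_iff one_pos).2 (Real.exp_lt_one_iff.2 (by linarith))
  refine ENNReal.add_ne_top.2 ⟨ENNReal.mul_ne_top hA (ENNReal.inv_ne_top.2 (tsub_pos_of_lt hlt1).ne'),
    ENNReal.mul_ne_top hA' (ENNReal.inv_ne_top.2 (tsub_pos_of_lt hlt2).ne')⟩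

end Main

section ShellBound

/-- **The summable shell bound.** Let `0 < n`, `φ : GL_n(𝔸_K) → ℂ` continuous, invariant under the centre
`A_G` and rapidly decreasing (`IsRapidlyDecreasingGL`), `Φ : 𝔸_Kⁿ → ℝ` non-negative, decaying to every
order in the archimedean variable and vanishing unless the finite part lies in a compact set (e.g. a
standard Schwartz–Bruhat function, `exists_shell_bound_of_isStandardSchwartzBruhat`, or
`e^{-‖y_∞‖} 𝟙_{𝒪̂ⁿ}(y_f)`), `σ > 1`, and Siegel data `Ω ⊆ B(𝔸_K)` compact, `t > 0`.
There is `ε : ℤ → [0, ∞]` with `Σ_j ε_j < ∞` such that for all `j`, all `τ ∈ [j, j+1]` and all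
`s ∈ Ω A_{T₀}(t) K`,

  `‖φ(s)‖² · |det(z s)|_𝔸^σ · Σ_{v ∈ Kⁿ ∖ 0} Φ(v (z s)) ≤ ε_j`,  `z = z(e^τ)`.

See the module docstring for the proof. [folklore] -/
theorem exists_shell_bound (hn : 0 < n) {φ : (AdelicGroupData.gl n K).Adelic → ℂ} (hφc : Continuous φ)
    (hφ : IsRapidlyDecreasingGL n K φ)
    (hφZ : ∀ (τ : ℝ) (g : GL (Fin n) (AdeleRing (𝓞 K) K)), φ (scalarExp n K τ * g) = φ g)
    {Φ : (Fin n → AdeleRing (𝓞 K) K) → ℝ} (hΦ0 : ∀ x, 0 ≤ Φ x)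
    (hdecay : ∀ k : ℕ, ∃ M : ℝ, 0 ≤ M ∧ ∀ x, ‖((Φ x : ℝ) : ℂ)‖ ≤ M * (1 + ‖vecInfinitePart K n x‖) ^ (-(k : ℝ)))
    (hCf : ∃ Cf : Set (Fin n → FiniteAdeleRing (𝓞 K) K), IsCompact Cf ∧ ∀ x, vecFinitePart K n x ∉ Cf → ((Φ x : ℝ) : ℂ) = 0)
    {σ : ℝ} (hσ : 1 < σ)
    {Ω : Set (GL (Fin n) (AdeleRing (𝓞 K) K))} (hΩc : IsCompact Ω)
    (hΩB : Ω ⊆ (standardParabolicGL (AdeleRing (𝓞 K) K) (id : Fin n → Fin n) : Set (GL (Fin n) (AdeleRing (𝓞 K) K))))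
    {t : ℝ} (ht : 0 < t) :
    ∃ ε : ℤ → ℝ≥0∞, (∑' j : ℤ, ε j) ≠ ⊤ ∧
      ∀ (j : ℤ) (τ : ℝ), τ ∈ Icc (j : ℝ) (j + 1) →
        ∀ s ∈ Ω * siegelCone n K t * (standardMaximalCompactGL n K : Set (GL (Fin n) (AdeleRing (𝓞 K) K))),
          ENNReal.ofReal (‖φ s‖ ^ 2) *
            (ENNReal.ofReal ((IdeleClassGroup.ideleNorm K (Matrix.GeneralLinearGroup.det (scalarExp n K τ * s)) : ℝ) ^ σ) *
              ∑' v : ↥{v : Fin n → K | v ≠ 0}, ENNReal.ofReal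
                (Φ (ratVec K v.1 ᵥ* ((scalarExp n K τ * s : GL (Fin n) (AdeleRing (𝓞 K) K)) :
                  Matrix (Fin n) (Fin n) (AdeleRing (𝓞 K) K))))) ≤ ε j := by
  haveI : T2Space (GL (Fin n) (AdeleRing (𝓞 K) K)) := t2Space_gl n K
  -- exponents
  set N : ℝ := (n : ℝ) * finrank ℚ K with hN
  have hd : (1 : ℝ) ≤ finrank ℚ K := Nat.one_le_cast.2 Module.finrank_pos
  have hn1 : (1 : ℝ) ≤ n := Nat.one_le_cast.2 hn
  have hN1 : 1 ≤ N := by rw [hN]; nlinarith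
  have hN0 : 0 < N := one_pos.trans_le hN1
  set k : ℕ := ⌈N * σ⌉₊ + 1 with hk
  have hkgt : N * σ < k := by
    rw [hk]; push_cast
    exact (Nat.le_ceil (N * σ)).trans_lt (lt_add_one _)
  set θ₁ : ℝ := (N + N * σ) / 2 with hθ₁
  have hθ₁gt : N < θ₁ := by rw [hθ₁]; nlinarith
  have hθ₁lt : θ₁ < N * σ := by rw [hθ₁]; nlinarith
  have hθ₁k : θ₁ ≤ k := (hθ₁lt.trans hkgt).le
  have hNk : N < k := by nlinarith
  -- the compact set of conjugates `C₁ = C_Ω · K`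
  have hKc : IsCompact (standardMaximalCompactGL n K : Set (GL (Fin n) (AdeleRing (𝓞 K) K))) :=
    isCompact_standardMaximalCompactGL n K
  obtain ⟨CΩ, hCΩc, hconj⟩ := exists_isCompact_conj_siegelCone_mem_of_subset ht hΩB hΩc
  set C₁ : Set (GL (Fin n) (AdeleRing (𝓞 K) K)) := CΩ * (standardMaximalCompactGL n K : Set (GL (Fin n) (AdeleRing (𝓞 K) K)))
    with hC₁
  have hC₁c : IsCompact C₁ := hCΩc.mul hKc
  -- the radial majorant `Φ₀` dominating `Φ(· c)`, `c ∈ C₁`, and its theta bound at scalars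
  obtain ⟨M, hM0, hM⟩ := hdecay k
  obtain ⟨Cf, hCfc, hCf⟩ := hCf
  obtain ⟨M', Cf', hM'0, hCf'c, hCf'cl, hdom⟩ := exists_radialMajorant_of_isCompact K hM0 hM hCfc hCf hC₁c
  obtain ⟨c, C, hc, hC, htheta⟩ := exists_tsum_theta_scalar_le (n := n) (K := K) (k := k) (M := M') hM'0
    (norm_radialMajorant_le hM'0 k Cf') hCf'c (fun x hx => radialMajorant_eq_zero M' k hx)
  set Z : ℝ → ℝ≥0∞ := fun θ => ∑' v : ↥{v : Fin n → K | v ≠ 0 ∧ vecFinitePart K n (ratVec K v ᵥ*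
      ((1 : GL (Fin n) (AdeleRing (𝓞 K) K)) : Matrix (Fin n) (Fin n) (AdeleRing (𝓞 K) K))) ∈ C},
    ENNReal.ofReal (‖vecInfinitePart K n (ratVec K (v : Fin n → K) ᵥ*
      ((1 : GL (Fin n) (AdeleRing (𝓞 K) K)) : Matrix (Fin n) (Fin n) (AdeleRing (𝓞 K) K)))‖ ^ (-θ)) with hZ
  have hZfin : ∀ θ : ℝ, N < θ → Z θ ≠ ⊤ := fun θ hθ =>
    (tsum_norm_vecInfinitePart_rpow_neg_lt_top K (n := n) 1 hC hθ).ne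
  -- the determinant on `C₁`
  obtain ⟨D, hD⟩ := hC₁c.exists_bound_of_continuousOn (continuous_glAbsDet_real n K).continuousOn
  set D' : ℝ := max D 1 with hD'
  have hD'1 : 1 ≤ D' := le_max_right _ _
  have hD'0 : 0 < D' := one_pos.trans_le hD'1
  have hD'le : ∀ y ∈ C₁, ((glAbsDet n K y : ℝ≥0) : ℝ) ≤ D' := fun y hy =>
    ((Real.le_norm_self _).trans (hD y hy)).trans (le_max_left _ _)
  -- rapid decay with `B = n k`
  have hB0 : (0 : ℝ) < (n : ℝ) * k := by
    have : (0 : ℝ) < k := hN0.trans hNk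
    positivity
  obtain ⟨Cφ, hCφ0, hφb⟩ := exists_uniform_rapidDecay n K hφc hφ hC₁c ht hB0
  set T : ℝ := max 1 t⁻¹ with hT
  have hT0 : 0 < T := lt_max_of_lt_left one_pos
  -- the constants `A(θ)` and the bound `ε`
  set A : ℝ → ℝ≥0∞ := fun θ =>
    ENNReal.ofReal (Cφ ^ 2 * D' ^ σ * M' * c ^ (-θ) * T ^ ((n : ℝ) * θ)) * Z θ with hA
  have hAfin : ∀ θ, N < θ → A θ ≠ ⊤ := fun θ hθ => ENNReal.mul_ne_top ENNReal.ofReal_ne_top (hZfin θ hθ)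
  set ε : ℤ → ℝ≥0∞ := fun j => if 0 ≤ j then A k * ENNReal.ofReal (Real.exp (j * (N * σ - k)))
    else A θ₁ * ENNReal.ofReal (Real.exp ((j + 1) * (N * σ - θ₁))) with hε
  refine ⟨ε, tsum_int_shellConst_ne_top (hAfin k hNk) (hAfin θ₁ hθ₁gt) (by linarith) (by linarith), ?_⟩
  -- the pointwise bound for a general `θ ∈ [0, k]`
  have key : ∀ θ : ℝ, 0 ≤ θ → θ ≤ k → ∀ (τ : ℝ),
      ∀ s ∈ Ω * siegelCone n K t * (standardMaximalCompactGL n K : Set (GL (Fin n) (AdeleRing (𝓞 K) K))),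
        ENNReal.ofReal (‖φ s‖ ^ 2) *
          (ENNReal.ofReal ((IdeleClassGroup.ideleNorm K (Matrix.GeneralLinearGroup.det (scalarExp n K τ * s)) : ℝ) ^ σ) *
            ∑' v : ↥{v : Fin n → K | v ≠ 0}, ENNReal.ofReal
              (Φ (ratVec K v.1 ᵥ* ((scalarExp n K τ * s : GL (Fin n) (AdeleRing (𝓞 K) K)) :
                Matrix (Fin n) (Fin n) (AdeleRing (𝓞 K) K))))) ≤
          A θ * ENNReal.ofReal (Real.exp (τ * (N * σ - θ))) := by
    intro θ hθ0 hθk τ s hs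
    -- decompose `s = ω a κ = a · y`, `y = (a⁻¹ ω a) κ ∈ C₁`
    obtain ⟨_, ⟨ω, hω, a, ha, rfl⟩, κ, hκ, rfl⟩ := hs
    obtain ⟨b, hprod, hroot, rfl⟩ := ha
    set a : GL (Fin n) (AdeleRing (𝓞 K) K) := posRealDiagonal n K b with ha'
    have hacone : a ∈ siegelCone n K t := ⟨b, hprod, hroot, rfl⟩
    set y : GL (Fin n) (AdeleRing (𝓞 K) K) := a⁻¹ * ω * a * κ with hy
    have hyC₁ : y ∈ C₁ := ⟨_, hconj a hacone ω hω, κ, hκ, rfl⟩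
    have hsay : ω * a * κ = a * y := by rw [hy]; group
    beta_reduce
    rw [hsay]
    -- rapid decay at `a y`
    obtain ⟨R, hR1, hRroot, hφay⟩ := hφb b hprod hroot y hyC₁
    have hR0 : 0 < R := one_pos.trans_le hR1
    set m₀ : ℝ := (T ^ n * R ^ n)⁻¹ with hm₀
    have hm₀pos : 0 < m₀ := inv_pos.2 (mul_pos (pow_pos hT0 n) (pow_pos hR0 n))
    have hm₀le : ∀ j, m₀ ≤ ((b j : ℝ≥0) : ℝ) := fun j => inv_le_of_siegelCone ht hn hprod hroot hR1 hRroot j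
    set m : ℝ≥0ˣ := Units.mk0 ⟨m₀, hm₀pos.le⟩ (by rw [Ne, ← NNReal.coe_eq_zero]; exact hm₀pos.ne') with hm
    have hmcoe : ((m : ℝ≥0) : ℝ) = m₀ := rfl
    have hmb : ∀ j, ((m : ℝ≥0) : ℝ) ≤ ((b j : ℝ≥0) : ℝ) := fun j => by rw [hmcoe]; exact hm₀le j
    -- (1) `‖φ(z a y)‖² = ‖φ(a y)‖² ≤ (Cφ R^{-B})²`
    have h1 : ENNReal.ofReal (‖φ (a * y)‖ ^ 2) ≤ ENNReal.ofReal ((Cφ * R ^ (-((n : ℝ) * k))) ^ 2) :=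
      ENNReal.ofReal_le_ofReal (pow_le_pow_left₀ (norm_nonneg _) hφay 2)
    -- (2) `|det (z a y)|^σ ≤ (e^{τN} D')^σ`
    have hdet : (IdeleClassGroup.ideleNorm K (Matrix.GeneralLinearGroup.det (scalarExp n K τ * (a * y))) : ℝ) ≤
        Real.exp τ ^ N * D' := by
      change ((glAbsDet n K (scalarExp n K τ * (a * y)) : ℝ≥0) : ℝ) ≤ _
      rw [map_mul, map_mul, glAbsDet_eq_one_of_mem_siegelCone hacone, one_mul, scalarExp, glAbsDet_posRealScalar,
        Units.val_mul, NNReal.coe_mul, Units.val_pow_eq_pow_val, NNReal.coe_pow, coe_expUnitNNReal, hN,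
        ← Real.rpow_natCast]
      push_cast
      exact mul_le_mul_of_nonneg_left (hD'le y hyC₁) (Real.rpow_nonneg (Real.exp_pos τ).le _)
    have h2 : ENNReal.ofReal ((IdeleClassGroup.ideleNorm K (Matrix.GeneralLinearGroup.det (scalarExp n K τ * (a * y))) : ℝ) ^ σ) ≤
        ENNReal.ofReal ((Real.exp τ ^ N * D') ^ σ) :=
      ENNReal.ofReal_le_ofReal (Real.rpow_le_rpow (NNReal.coe_nonneg _) hdet (by linarith))
    -- (3) the theta sum: domination and the scalar bound at `ρ = e^τ m`
    have h3 : ∑' v : ↥{v : Fin n → K | v ≠ 0}, ENNReal.ofReal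
        (Φ (ratVec K v.1 ᵥ* ((scalarExp n K τ * (a * y) : GL (Fin n) (AdeleRing (𝓞 K) K)) :
          Matrix (Fin n) (Fin n) (AdeleRing (𝓞 K) K)))) ≤
        ENNReal.ofReal (M' * (c * (Real.exp τ * m₀)) ^ (-θ)) * Z θ := by
      have hdom' : ∀ c' ∈ C₁, ∀ x : Fin n → AdeleRing (𝓞 K) K,
          ‖((Φ (x ᵥ* (c' : Matrix (Fin n) (Fin n) (AdeleRing (𝓞 K) K))) : ℝ) : ℂ)‖ ≤
            ‖(((M' * (1 + ‖vecInfinitePart K n x‖) ^ (-(k : ℝ)) *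
              Cf'.indicator (fun _ => (1 : ℝ)) (vecFinitePart K n x) : ℝ) : ℂ))‖ := fun c' hc' x => hdom c' hc' x
      refine (le_of_eq (by rw [← mul_assoc])).trans ((tsum_theta_siegel_le hΦ0 hM'0 k Cf' hdom' hyC₁ hmb τ).trans ?_)
      have h := htheta θ hθ0 hθk (expUnitNNReal τ * m)
      rw [Units.val_mul, NNReal.coe_mul, coe_expUnitNNReal, hmcoe] at h
      exact h
    -- combine with the real bookkeeping
    have hreal := shell_real_bound (n := n) (N := N) (k := k) (Cφ := Cφ) (D := D') (Dσ := D' ^ σ) (M := M') (σ := σ)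
      (by rw [Real.mul_rpow (Real.rpow_nonneg (Real.exp_pos τ).le _) hD'0.le, ← Real.rpow_mul (Real.exp_pos τ).le])
      (Real.rpow_nonneg hD'0.le σ) hM'0 hc hT0 hR1 hm₀pos (le_refl m₀) (rfl : Real.exp τ = Real.exp τ) hθ0 hθk
    calc ENNReal.ofReal (‖φ (a * y)‖ ^ 2) *
          (ENNReal.ofReal ((IdeleClassGroup.ideleNorm K (Matrix.GeneralLinearGroup.det (scalarExp n K τ * (a * y))) : ℝ) ^ σ) *
            ∑' v : ↥{v : Fin n → K | v ≠ 0}, ENNReal.ofReal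
              (Φ (ratVec K v.1 ᵥ* ((scalarExp n K τ * (a * y) : GL (Fin n) (AdeleRing (𝓞 K) K)) :
                Matrix (Fin n) (Fin n) (AdeleRing (𝓞 K) K)))))
        ≤ ENNReal.ofReal ((Cφ * R ^ (-((n : ℝ) * k))) ^ 2) *
            (ENNReal.ofReal ((Real.exp τ ^ N * D') ^ σ) * (ENNReal.ofReal (M' * (c * (Real.exp τ * m₀)) ^ (-θ)) * Z θ)) := by
          gcongr
    _ = ENNReal.ofReal ((Cφ * R ^ (-((n : ℝ) * k))) ^ 2 * (Real.exp τ ^ N * D') ^ σ * (M' * (c * (Real.exp τ * m₀)) ^ (-θ))) * Z θ := by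
          have hY : 0 ≤ (Real.exp τ ^ N * D') ^ σ :=
            Real.rpow_nonneg (mul_nonneg (Real.rpow_nonneg (Real.exp_pos τ).le _) hD'0.le) _
          rw [ENNReal.ofReal_mul (mul_nonneg (sq_nonneg _) hY), ENNReal.ofReal_mul (sq_nonneg _)]
          ring
    _ ≤ ENNReal.ofReal ((Cφ ^ 2 * D' ^ σ * M' * c ^ (-θ) * T ^ ((n : ℝ) * θ)) * Real.exp (τ * (N * σ - θ))) * Z θ := by
          gcongr
    _ = A θ * ENNReal.ofReal (Real.exp (τ * (N * σ - θ))) := by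
          rw [hA, ENNReal.ofReal_mul (by positivity)]
          ring
  -- specialise `θ` on the two half-lines of shells
  intro j τ hτ s hs
  have hφs : ‖φ s‖ = ‖φ (scalarExp n K τ * s)‖ := by rw [hφZ]
  by_cases hj : 0 ≤ j
  · have h := key k (hN0.trans hNk).le le_rfl τ s hs
    refine h.trans ?_
    simp only [hε, hj, if_true]
    refine mul_le_mul_right (ENNReal.ofReal_le_ofReal (Real.exp_le_exp.2 ?_)) _
    -- `τ (Nσ - k) ≤ j (Nσ - k)` as `Nσ - k < 0` and `j ≤ τ`
    nlinarith [hτ.1, hkgt]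
  · have h := key θ₁ (hN0.trans hθ₁gt).le hθ₁k τ s hs
    refine h.trans ?_
    simp only [hε, hj, if_false]
    refine mul_le_mul_right (ENNReal.ofReal_le_ofReal (Real.exp_le_exp.2 ?_)) _
    -- `τ (Nσ - θ₁) ≤ (j+1) (Nσ - θ₁)` as `Nσ - θ₁ > 0` and `τ ≤ j + 1`
    nlinarith [hτ.2, hθ₁lt]

/-- The same for `(Φ : ℂ)` a standard Schwartz–Bruhat function (`IsStandardSchwartzBruhat.exists_norm_le_rpow_neg`,
`exists_isCompact_eq_zero`). [folklore] -/
theorem exists_shell_bound_of_isStandardSchwartzBruhat (hn : 0 < n) {φ : (AdelicGroupData.gl n K).Adelic → ℂ}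
    (hφc : Continuous φ) (hφ : IsRapidlyDecreasingGL n K φ)
    (hφZ : ∀ (τ : ℝ) (g : GL (Fin n) (AdeleRing (𝓞 K) K)), φ (scalarExp n K τ * g) = φ g)
    {Φ : (Fin n → AdeleRing (𝓞 K) K) → ℝ} (hΦ0 : ∀ x, 0 ≤ Φ x)
    (hΦS : IsStandardSchwartzBruhat K n fun x => ((Φ x : ℝ) : ℂ)) {σ : ℝ} (hσ : 1 < σ)
    {Ω : Set (GL (Fin n) (AdeleRing (𝓞 K) K))} (hΩc : IsCompact Ω)
    (hΩB : Ω ⊆ (standardParabolicGL (AdeleRing (𝓞 K) K) (id : Fin n → Fin n) : Set (GL (Fin n) (AdeleRing (𝓞 K) K))))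
    {t : ℝ} (ht : 0 < t) :
    ∃ ε : ℤ → ℝ≥0∞, (∑' j : ℤ, ε j) ≠ ⊤ ∧
      ∀ (j : ℤ) (τ : ℝ), τ ∈ Icc (j : ℝ) (j + 1) →
        ∀ s ∈ Ω * siegelCone n K t * (standardMaximalCompactGL n K : Set (GL (Fin n) (AdeleRing (𝓞 K) K))),
          ENNReal.ofReal (‖φ s‖ ^ 2) *
            (ENNReal.ofReal ((IdeleClassGroup.ideleNorm K (Matrix.GeneralLinearGroup.det (scalarExp n K τ * s)) : ℝ) ^ σ) *
              ∑' v : ↥{v : Fin n → K | v ≠ 0}, ENNReal.ofReal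
                (Φ (ratVec K v.1 ᵥ* ((scalarExp n K τ * s : GL (Fin n) (AdeleRing (𝓞 K) K)) :
                  Matrix (Fin n) (Fin n) (AdeleRing (𝓞 K) K))))) ≤ ε j :=
  exists_shell_bound hn hφc hφ hφZ hΦ0 (fun k => hΦS.exists_norm_le_rpow_neg k) hΦS.exists_isCompact_eq_zero hσ hΩc hΩB ht

end ShellBound

end Literature.NumberTheory.Automorphic
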